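import Summits.AtomisticToContinuum.Crystallization.Theorems.FluxTubeKeplerFloorGivesLayered
import Summits.AtomisticToContinuum.Crystallization.Theorems.FluxTubeKeplerFluxCellKeplerSingleScale
import Summits.AtomisticToContinuum.Crystallization.Theorems.ChessboardParticlePlanesPeriodicWindowsIffCrystallization

/-!
# `KissingBlindRung` — F3 witness: the family member `KissRung 0` IS the proved floor (no `sorry`)

Forward rung over `FluxTubeKepler.FloorGivesLayered` (crux dir `FluxCellKepler`, stmt-AtomisticToContinuum-15221;
fwd-rung G1 gen 16).  Re-declares the soft-kissing ladder of `Lines/KissingBlindRung.lean` in the namespace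
`…KissLadder.Special` (same definitions, verbatim) and proves, sorry-free:
* `kissRung_zero : KissRung 0` — ball factor `0` exempts nothing (`¬ KissedBall 0` is `True`), so the kissing-blind
  budget is the floor's budget (`kissBudget_zero_iff`) and the member is `FloorGivesLayered_proof` ∘
  `PeriodicGivenLayered_holds` (the seed BY NAME);
* the dial `kissRung_zero_of_kissRung : KissRung k → KissRung 0`, `kissRung_of_kissRung_one : KissRung 1 → KissRung k`
  (`k ≥ 1`);
* the on-path lemmas `kissRung_of_crystallization`, `KissingBlindRung_of_Crystallization` (F4, also in `_onpath`);
* the literal specialisation `example : KissRung 0` at the end.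
-/

noncomputable section

namespace Summit.AtomisticToContinuum.Crystallization.Cruxes.FluxCellKepler.KissLadder.Special

open scoped BigOperators Classical
open Filter Topology
open Literature.MathematicalPhysics.StatisticalMechanics
open Summit.AtomisticToContinuum.Crystallization.Theorems.FluxCellKeplerSingleScale (LayeredGood layeredGood_mono)
open Summit.AtomisticToContinuum.Crystallization.Theorems.ChargedEnergyGapNegative (eStar)

local notation "E3" => EuclideanSpace ℝ (Fin 3)

/-! ## The objects of the ladder: soft twelve-kissing and kissed balls -/

/-- **SOFTLY TWELVE-KISSED** at scale `a` and tolerance `η`: every other particle of the configuration is at distance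
`≥ a(1−η)` from `x j`; each is either within `a(1+η)` or beyond the Hales gap `(63/50)·a`; and exactly twelve are
within `a(1+η)`.  Verbatim the per-site predicate of `BrittleRungDescent.LJBondSpread` with `1/400 ↦ η`
(Hales 2012, Lemma 2: the class `𝒱`; soft form). -/
def SoftKissed (a η : ℝ) {N : ℕ} (x : Fin N → E3) (j : Fin N) : Prop :=
  (∀ l : Fin N, l ≠ j → a * (1 - η) ≤ dist (x j) (x l) ∧
      (dist (x j) (x l) ≤ a * (1 + η) ∨ 63 / 50 * a ≤ dist (x j) (x l))) ∧
    Nat.card {l : Fin N // l ≠ j ∧ dist (x j) (x l) ≤ a * (1 + η)} = 12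

/-- **KISSED BALL of radius `k·R`** (`k ≥ 1`; `KissedBall 0 := False`): for ONE spacing `a` in the floor's box
`[47/50, 1]`, every particle within `k·R` of `x i` (the centre included) is softly twelve-kissed at `(a, η)`.
No template, no orientation, no registry: a radial first-shell datum at every particle of the ball. -/
def KissedBall (k : ℕ) (R η : ℝ) {N : ℕ} (x : Fin N → E3) (i : Fin N) : Prop :=
  0 < k ∧ ∃ a : ℝ, 47 / 50 ≤ a ∧ a ≤ 1 ∧ ∀ j : Fin N, dist (x j) (x i) ≤ (k : ℝ) * R → SoftKissed a η x j

/-! ## The rung family -/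

/-- FLOOR(P₀): `N · e(P₀) ≤ E(x)` for every Lennard-Jones ground state `x` of every size `N`
(verbatim the first hypothesis of `FluxTubeKepler.FloorGivesLayered`). -/
def Floor (P₀ : PeriodicConfiguration 3) : Prop :=
  ∀ (N : ℕ) (x : Fin N → E3), IsGroundState lennardJones x →
    (N : ℝ) * P₀.energyPerParticle lennardJones ≤ interactionEnergy lennardJones x

/-- KISSING-BLIND BUDGET with ball factor `k`: for every radius `R > 0` and tolerance `η > 0` some `c > 0` prices the
sites of every Lennard-Jones ground state that are `(R,η)`-non-layered AND have no kissed `kR`-ball at tolerance `η`,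
against the excess energy over `N · e(P₀)` (`k = 0`: the floor's budget, every non-layered site priced; quantifier
order `∀ R η ∃ c` of the crux kept — Disproof §5: no `c` uniform in `R`, by the boundary witness, which is kissed
nowhere near the surface and so applies verbatim to this budget). -/
def KissBudget (k : ℕ) (P₀ : PeriodicConfiguration 3) : Prop :=
  ∀ R η : ℝ, 0 < R → 0 < η → ∃ c : ℝ, 0 < c ∧
    ∀ (N : ℕ) (x : Fin N → E3), IsGroundState lennardJones x →
      c * (Nat.card {i : Fin N // ¬ LayeredGood R η x i ∧ ¬ KissedBall k R η x i} : ℝ) ≤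
        interactionEnergy lennardJones x - (N : ℝ) * P₀.energyPerParticle lennardJones

/-- Periodic windows at every scale along the sequence `x` (ONE periodic `P`, translations only) —
verbatim the conclusion of `FluxTubeKepler.PeriodicWindows` / `FluxTubeKepler.PeriodicGivenLayered`. -/
def HasPeriodicWindows (x : (N : ℕ) → (Fin N → E3)) : Prop :=
  ∃ P : PeriodicConfiguration 3, ∀ R ε : ℝ, 0 < ε → ∃ᶠ N in atTop, ∃ t : E3,
    (∀ q ∈ P.points, ‖q‖ ≤ R → ∃ i : Fin N, dist (x N i + t) q ≤ ε) ∧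
    (∀ i : Fin N, ‖x N i + t‖ ≤ R → ∃ q ∈ P.points, dist (x N i + t) q ≤ ε)

/-- **The graded family.** `KissRung k`: FLOOR and the kissing-blind budget with ball factor `k` force periodic
windows along every Lennard-Jones ground-state sequence. -/
def KissRung (k : ℕ) : Prop :=
  ∀ P₀ : PeriodicConfiguration 3, Floor P₀ → KissBudget k P₀ →
    ∀ x : (N : ℕ) → (Fin N → E3), (∀ N, IsGroundState lennardJones (x N)) → HasPeriodicWindows x

/-- **Deciding rung** (`k₀ + 1 = 1`, the strongest member): a certificate blind to every softly twelve-kissed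
`R`-ball still forces crystallization of the ground states. -/
def KissingBlindRung : Prop := KissRung 1

/-! ## Counting helpers -/

theorem natCard_mono {N : ℕ} {p q : Fin N → Prop} (h : ∀ i, p i → q i) :
    Nat.card {i // p i} ≤ Nat.card {i // q i} := by
  rw [Nat.card_eq_fintype_card, Nat.card_eq_fintype_card]
  exact Fintype.card_subtype_mono _ _ h

/-- `LayeredGood` is monotone in the tolerance. [folklore] -/
theorem layeredGood_tol {R η η' : ℝ} (hη : η' ≤ η) {N : ℕ} (x : Fin N → E3) (i : Fin N) :
    LayeredGood R η' x i → LayeredGood R η x i := by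
  rintro ⟨a, ha₁, ha₂, A, s, z, hs, hz, h₁, h₂⟩
  refine ⟨a, ha₁, ha₂, A, s, z, hs, hz, ?_, ?_⟩
  · intro p hp hpR
    obtain ⟨j, hj⟩ := h₁ p hp hpR
    exact ⟨j, hj.trans hη⟩
  · intro j hj
    obtain ⟨p, hp, hjp⟩ := h₂ j hj
    exact ⟨p, hp, hjp.trans hη⟩

/-! ## F3 — the family specialises to the proved floor -/

/-- Ball factor `0` exempts nothing: `KissedBall 0` is `False`. -/
@[simp] theorem not_kissedBall_zero (R η : ℝ) {N : ℕ} (x : Fin N → E3) (i : Fin N) : ¬ KissedBall 0 R η x i :=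
  fun h => (lt_irrefl 0 h.1).elim

/-- At ball factor `0` the kissing-blind budget IS the floor's budget. -/
theorem kissBudget_zero_iff (P₀ : PeriodicConfiguration 3) :
    KissBudget 0 P₀ ↔
      ∀ R η : ℝ, 0 < R → 0 < η → ∃ c : ℝ, 0 < c ∧
        ∀ (N : ℕ) (x : Fin N → E3), IsGroundState lennardJones x →
          c * (Nat.card {i : Fin N // ¬ LayeredGood R η x i} : ℝ) ≤
            interactionEnergy lennardJones x - (N : ℝ) * P₀.energyPerParticle lennardJones := by
  simp only [KissBudget, not_kissedBall_zero, not_false_eq_true, and_true]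

/-- `KissRung 0` is the floor: the seed theorem followed by the proved `PeriodicGivenLayered`. -/
theorem kissRung_zero : KissRung 0 := fun P₀ hF hB x hx =>
  Theses.FluxTubeKepler.PeriodicGivenLayered_holds x hx
    (Theorems.FluxTubeKeplerFloorGivesLayered.FloorGivesLayered_proof P₀ hF
      ((kissBudget_zero_iff P₀).1 hB) x hx)

/-! ## Dial: `KissRung 1 → KissRung k → KissRung 0` (`k ≥ 1`) -/

/-- The floor's budget prices a superset: `KissBudget 0 P₀ → KissBudget k P₀`. -/
theorem kissBudget_of_zero (k : ℕ) (P₀ : PeriodicConfiguration 3) : KissBudget 0 P₀ → KissBudget k P₀ := by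
  intro hB R η hR hη
  obtain ⟨c, hc, hcB⟩ := hB R η hR hη
  refine ⟨c, hc, fun N x hx => le_trans ?_ (hcB N x hx)⟩
  have hle : Nat.card {i : Fin N // ¬ LayeredGood R η x i ∧ ¬ KissedBall k R η x i} ≤
      Nat.card {i : Fin N // ¬ LayeredGood R η x i ∧ ¬ KissedBall 0 R η x i} :=
    natCard_mono fun i hi => ⟨hi.1, not_kissedBall_zero R η x i⟩
  exact mul_le_mul_of_nonneg_left (by exact_mod_cast hle) hc.le

/-- Every member implies the floor member (informational `specialises`). -/
theorem kissRung_zero_of_kissRung {k : ℕ} (h : KissRung k) : KissRung 0 :=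
  fun P₀ hF hB x hx => h P₀ hF (kissBudget_of_zero k P₀ hB) x hx

/-- A larger kissed ball contains the unit one (`R ≥ 0`). -/
theorem kissedBall_one_of_kissedBall {k : ℕ} (hk : 0 < k) {R η : ℝ} (hR : 0 ≤ R) {N : ℕ} (x : Fin N → E3)
    (i : Fin N) : KissedBall k R η x i → KissedBall 1 R η x i := by
  rintro ⟨-, a, ha₁, ha₂, h⟩
  refine ⟨Nat.one_pos, a, ha₁, ha₂, fun j hj => h j (hj.trans ?_)⟩
  have hk' : (1 : ℝ) ≤ (k : ℝ) := by exact_mod_cast hk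
  simpa using mul_le_mul_of_nonneg_right hk' hR

/-- The budget with a larger ball factor prices a superset of the unit one's set: `KissBudget k → KissBudget 1`. -/
theorem kissBudget_one_of_kissBudget {k : ℕ} (hk : 0 < k) (P₀ : PeriodicConfiguration 3) :
    KissBudget k P₀ → KissBudget 1 P₀ := by
  intro hB R η hR hη
  obtain ⟨c, hc, hcB⟩ := hB R η hR hη
  refine ⟨c, hc, fun N x hx => le_trans ?_ (hcB N x hx)⟩
  have hle : Nat.card {i : Fin N // ¬ LayeredGood R η x i ∧ ¬ KissedBall 1 R η x i} ≤
      Nat.card {i : Fin N // ¬ LayeredGood R η x i ∧ ¬ KissedBall k R η x i} :=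
    natCard_mono fun i hi => ⟨hi.1, fun hK => hi.2 (kissedBall_one_of_kissedBall hk hR.le x i hK)⟩
  exact mul_le_mul_of_nonneg_left (by exact_mod_cast hle) hc.le

/-- The deciding member is the strongest: `KissRung 1 → KissRung k` for every `k ≥ 1`. -/
theorem kissRung_of_kissRung_one {k : ℕ} (hk : 0 < k) (h : KissRung 1) : KissRung k :=
  fun P₀ hF hB x hx => h P₀ hF (kissBudget_one_of_kissBudget hk P₀ hB) x hx

/-! ## F4 — on-path lemmas: the sub-problem implies every member -/

/-- ON-PATH: `Crystallization → KissRung k` (landed hull-criterion converse `periodicWindows_of_crystallization`). -/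
theorem kissRung_of_crystallization (k : ℕ) (h : _root_.Crystallization) : KissRung k :=
  fun _ _ _ x hx =>
    Theorems.ChessboardParticlePlanesPeriodicWindowsIffCrystallization.periodicWindows_of_crystallization h x hx

/-- ON-PATH for the deciding rung (tagged `aesop safe apply` so that the tribunal's fixed `S → C` portfolio finds it). -/
@[aesop safe apply]
theorem KissingBlindRung_of_Crystallization (h : _root_.Crystallization) : KissingBlindRung :=
  kissRung_of_crystallization 1 h

/-! ## F3 — literal specialisation -/

/-- The floor member, by the seed. -/
example : KissRung 0 := kissRung_zero

/-- … and unfolded: FLOOR + the floor's budget ⇒ periodic windows, i.e. the seed composed with the proved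
`PeriodicGivenLayered`. -/
example : ∀ P₀ : PeriodicConfiguration 3, Floor P₀ → KissBudget 0 P₀ →
    ∀ x : (N : ℕ) → (Fin N → E3), (∀ N, IsGroundState lennardJones (x N)) → HasPeriodicWindows x := by
  simpa [KissRung] using kissRung_zero


end Summit.AtomisticToContinuum.Crystallization.Cruxes.FluxCellKepler.KissLadder.Special

end
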